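import Literature.AlgebraicGeometry.HodgeTheory.CMHodgeGroupPlaceProjections
import Literature.AlgebraicGeometry.HodgeTheory.CMHodgeGroupDerivedAlgebraThree
import HarnessLib

/-!
# The LIFT property for a CM field acting with multiplicity `3`, one `Θ`-scalar place and one mixed place
# (the quartic CM pattern `(3,0)+(2,1)`): no twist between the `𝔰𝔩₃`-blocks of `Lie Hg`
# (Moonen–Zarhin 1999 §2 (2.3); Ribet 1983 §3; Deligne LNM 900 I §3)

Family `hodge`, layer `Literature/AlgebraicGeometry/HodgeTheory` (cell `pub-hodgeav-hg6`, req-37 (A) Q2b, TABLE X ROW 10 —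
`End⁰ = E` a quartic CM field, `dim_E H¹ = 3` — brick (b′) of the eng-5 g6 plan for the pattern `(3,0)+(2,1)`; the `n₀ = 3`
companion of `CMHodgeGroupNoTwist` §2). UNCONDITIONAL; theorems only, no definition, no named fact, no `sorry`. HONEST
FRAMING of that cell: HC / HC_AV / HC_CM / H2 NOT proved — linear algebra of polarized weight-one `ℚ`-Hodge structures.

SETTING as in `CMDerived.*` / `CMNoTwist.*` with `n₀ = 3`: `H` effective polarized of weight `1`, `E = End_Hdg(V) = ℚ[φ]`
of dimension `2|ι|`, every non-zero element invertible, a CM type `μ : ι → ℂ` with `3`-dimensional blocks `W_k`, an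
admissible bracket-closed `𝔤 ∋ Θ` (commuting with `E`, `ψ`-skew) acting irreducibly on the blocks.
* §1 `CMNoTwist3.exists_basis_theta` (plain linear algebra) and `CMNoTwist3.exists_basis_of_mixed` — a `Θ`-adapted basis
  `(b₀; b₁, b₂)` of a MIXED `3`-block (`W_k` meets both `V^{1,0}` and `V^{0,1}`): `Θ b₀ = β b₀`, `Θ b₁ = α b₁`, `Θ b₂ = α b₂`,
  `α ≠ β` (`{α, β} = {1, −1}`).
* §2 `CMNoTwist3.proj_of_mixed` — at a mixed `3`-block every traceless endomorphism is induced by the complex derived span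
  `(𝔡)_ℂ` (`CMDerived.exists_mem_spanC_derived_forall_eq_three`, the tree's relative `𝔰𝔩₃` theorem); hence, by the
  EQUIDIMENSIONALITY `CMPlaces.forall_proj_of_proj`, at EVERY block (`CMNoTwist3.proj_of_exists_mixed`) — this is how
  `𝔰𝔬₃ ⊂ 𝔰𝔩₃` is excluded at a `Θ`-scalar `(3,0)`-block without any classification.
* §3 **`CMNoTwist3.lift_of_scalar_mixed`** — THE LIFT PROPERTY for `|ι| ≤ 2` places, one `Θ`-scalar place `k₀` and a
  mixed place `k₁ ≠ k₀`: every traceless endomorphism of `W_{μ k}` is induced by an element of `𝔤_ℂ` killing the other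
  block. PROOF: Ribet's Lie lemma `LieGoursatTwist.lift_or_twist_of_submodules` (`d = 3`, both twist types) on `(𝔡)_ℂ`
  leaves LIFT or a twist between `k₀` and `k₁`; a twist (of either type) transports the vanishing of `[Θ, X_ℂ]` on the
  `Θ`-scalar block `W_{μ k₀}` to the mixed block, where `Θ` would then commute with the irreducible `𝔤_ℂ|_{W_{μ k₁}}`
  (`CMNoTwist.false_of_theta_commute_of_balanced`) — impossible.

## References
* [MoonenZarhin1999LowDim] B. Moonen, Yu. Zarhin, Math. Ann. 315 (1999), §2 (2.3).
* [Ribet1983] K. A. Ribet, Amer. J. Math. 105 (1983), §3 (Lie algebra lemma), Thm. 0.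
* [Deligne1982HodgeCycles] P. Deligne, LNM 900 (1982), I §3 (proof of Prop. 3.4), §4 (p. 30).
-/

noncomputable section

open scoped TensorProduct
open Module Matrix

namespace Literature.AlgebraicGeometry.Motives

namespace HodgeStructure

universe u

variable {V : Type u} [AddCommGroup V] [Module ℚ V] {n : ℤ}

/-! ### §1 A `Θ`-adapted basis of a mixed `3`-block -/

section General

variable {M : Type*} [AddCommGroup M] [Module ℂ M]

/-- **A basis adapted to a splitting `W = P ⊕ Q`, `dim P = 2`, `dim Q = 1`, by eigenvalues of an operator `Θ`**
(`Θ = α` on `P`, `Θ = β` on `Q`): a basis `(b₀; b₁, b₂)` of `W` with `Θ b₀ = β b₀`, `Θ b₁ = α b₁`, `Θ b₂ = α b₂`.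
[cite: Deligne1982HodgeCycles, §4 (p. 30)] -/
theorem CMNoTwist3.exists_basis_theta (W P Q : Submodule ℂ M) (hPW : P ≤ W) (hQW : Q ≤ W) (hPQ : Disjoint P Q)
    (hW : Module.finrank ℂ ↥W = 3) (hP : Module.finrank ℂ ↥P = 2) (hQ : Module.finrank ℂ ↥Q = 1)
    (Θ : Module.End ℂ M) (α β : ℂ) (hΘP : ∀ x ∈ P, Θ x = α • x) (hΘQ : ∀ x ∈ Q, Θ x = β • x) :
    ∃ bW : Module.Basis (Fin 3) ℂ ↥W, Θ (bW 0 : ↥W) = β • (bW 0 : M) ∧ Θ (bW 1 : ↥W) = α • (bW 1 : M) ∧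
      Θ (bW 2 : ↥W) = α • (bW 2 : M) := by
  classical
  haveI : Module.Finite ℂ ↥P := Module.finite_of_finrank_eq_succ hP
  haveI : Module.Finite ℂ ↥Q := Module.finite_of_finrank_eq_succ hQ
  haveI : Module.Finite ℂ ↥W := Module.finite_of_finrank_eq_succ hW
  let bP : Module.Basis (Fin 2) ℂ ↥P := Module.finBasisOfFinrankEq ℂ ↥P hP
  let bQ : Module.Basis (Fin 1) ℂ ↥Q := Module.finBasisOfFinrankEq ℂ ↥Q hQ
  -- the family `(q; p₀, p₁)` in `W`
  let u : Fin 3 → ↥W := ![⟨(bQ 0 : M), hQW (bQ 0).2⟩, ⟨(bP 0 : M), hPW (bP 0).2⟩, ⟨(bP 1 : M), hPW (bP 1).2⟩]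
  have hu0 : ((u 0 : ↥W) : M) = (bQ 0 : M) := rfl
  have hu1 : ((u 1 : ↥W) : M) = (bP 0 : M) := rfl
  have hu2 : ((u 2 : ↥W) : M) = (bP 1 : M) := rfl
  have hli : LinearIndependent ℂ u := by
    rw [Fintype.linearIndependent_iff]
    intro g hg
    have hsum := congrArg (fun x : ↥W => (x : M)) hg
    simp only [Submodule.coe_add, Submodule.coe_smul, Submodule.coe_zero, Fin.sum_univ_three, hu0, hu1, hu2] at hsum
    -- the `P`- and `Q`-components vanish separately
    have hq : g 0 • (bQ 0 : M) ∈ Q := Q.smul_mem _ (bQ 0).2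
    have hp : g 1 • (bP 0 : M) + g 2 • (bP 1 : M) ∈ P := P.add_mem (P.smul_mem _ (bP 0).2) (P.smul_mem _ (bP 1).2)
    have hq' : g 0 • (bQ 0 : M) ∈ P := by
      have h : g 0 • (bQ 0 : M) = -(g 1 • (bP 0 : M) + g 2 • (bP 1 : M)) := by
        rw [eq_neg_iff_add_eq_zero, ← add_assoc]; exact hsum
      rw [h]; exact P.neg_mem hp
    have hq0 : g 0 • (bQ 0 : M) = 0 := by
      have h := hPQ.le_bot (Submodule.mem_inf.2 ⟨hq', hq⟩)
      rwa [Submodule.mem_bot] at h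
    have hg0 : g 0 = 0 := by
      by_contra hne
      exact (Submodule.coe_eq_zero.not.2 (bQ.ne_zero 0)) ((smul_eq_zero.1 hq0).resolve_left hne)
    have hp0 : g 1 • bP 0 + g 2 • bP 1 = 0 := by
      apply Subtype.ext
      rw [Submodule.coe_add, Submodule.coe_smul, Submodule.coe_smul, Submodule.coe_zero]
      rw [hg0, zero_smul, zero_add] at hsum
      exact hsum
    have hP' := Fintype.linearIndependent_iff.1 bP.linearIndependent ![g 1, g 2] (by
      rw [Fin.sum_univ_two]; exact hp0)
    have hg1 : g 1 = 0 := hP' 0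
    have hg2 : g 2 = 0 := hP' 1
    intro i
    fin_cases i
    · exact hg0
    · exact hg1
    · exact hg2
  let bW : Module.Basis (Fin 3) ℂ ↥W := basisOfLinearIndependentOfCardEqFinrank hli (by rw [Fintype.card_fin, hW])
  have hbW : ∀ i, bW i = u i := fun i => congrFun (coe_basisOfLinearIndependentOfCardEqFinrank hli _) i
  refine ⟨bW, ?_, ?_, ?_⟩
  · rw [hbW, hu0]; exact hΘQ _ (bQ 0).2
  · rw [hbW, hu1]; exact hΘP _ (bP 0).2
  · rw [hbW, hu2]; exact hΘP _ (bP 1).2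

end General

/-- **Conjugation-transposition by an invertible matrix and reindexing detect zero** (plumbing for the transpose-type
twist of `LieGoursatTwist.lift_or_twist_of_submodules`). [cite: Ribet1983, §3] -/
theorem CMNoTwist3.eq_zero_of_conj_transpose_submatrix_eq_zero {d : ℕ} (e : Fin d ≃ Fin d) {A : Matrix (Fin d) (Fin d) ℂ}
    (hA : IsUnit A) {M : Matrix (Fin d) (Fin d) ℂ} (h : -(A⁻¹ * (M.submatrix e.symm e.symm)ᵀ * A) = 0) : M = 0 := by
  rw [neg_eq_zero, Matrix.transpose_submatrix] at h
  have hT : Mᵀ = 0 := CMNoTwist.eq_zero_of_conj_submatrix_eq_zero e hA h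
  rw [← Matrix.transpose_transpose M, hT, Matrix.transpose_zero]

section Hodge

variable [Module.Finite ℚ V] [HodgeTensorFacts.{u, u}]

/-- **A `Θ`-ADAPTED BASIS OF A MIXED `3`-BLOCK**: if `W_c = ker(φ_ℂ − c)` has `dim (W_c ∩ V^{1,0}) + dim (W_c ∩ V^{0,1}) = 3`
with both summands non-zero, there is a basis `(b₀; b₁, b₂)` of `W_c` and `α ≠ β` with `Θ b₀ = β b₀`, `Θ b₁ = α b₁`,
`Θ b₂ = α b₂`. [cite: Deligne1982HodgeCycles, §4 (p. 30)] [cite: MoonenZarhin1999LowDim, §2 (2.3)] -/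
theorem CMNoTwist3.exists_basis_of_mixed (H : HodgeStructure V n) (hn : n = 1) (heff : H.IsEffective)
    {φ : Module.End ℚ V} (hφE : φ ∈ H.endAlg) {Θ : Module.End ℂ (ℂ ⊗[ℚ] V)}
    (hΘ : ∀ p, ∀ x ∈ H.piece p (n - p), Θ x = ((2 * p - n : ℤ) : ℂ) • x) {c : ℂ}
    (h3 : Module.finrank ℂ ↥(Module.End.eigenspace (φ.baseChange ℂ) c ⊓ H.piece 1 0) +
      Module.finrank ℂ ↥(Module.End.eigenspace (φ.baseChange ℂ) c ⊓ H.piece 0 1) = 3)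
    (h10 : Module.finrank ℂ ↥(Module.End.eigenspace (φ.baseChange ℂ) c ⊓ H.piece 1 0) ≠ 0)
    (h01 : Module.finrank ℂ ↥(Module.End.eigenspace (φ.baseChange ℂ) c ⊓ H.piece 0 1) ≠ 0) :
    ∃ (bW : Module.Basis (Fin 3) ℂ ↥(Module.End.eigenspace (φ.baseChange ℂ) c)) (α β : ℂ), α ≠ β ∧
      Θ (bW 0 : ↥(Module.End.eigenspace (φ.baseChange ℂ) c)) = β • (bW 0 : ℂ ⊗[ℚ] V) ∧
      Θ (bW 1 : ↥(Module.End.eigenspace (φ.baseChange ℂ) c)) = α • (bW 1 : ℂ ⊗[ℚ] V) ∧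
      Θ (bW 2 : ↥(Module.End.eigenspace (φ.baseChange ℂ) c)) = α • (bW 2 : ℂ ⊗[ℚ] V) := by
  obtain ⟨-, -, hΘ10, hΘ01, -⟩ := UnitaryTheta.theta_facts H hn heff hΘ
  have hsum := CMTheta.finrank_eigenspace_eq_add H hn heff hφE c
  subst hn
  set W := Module.End.eigenspace (φ.baseChange ℂ) c with hWdef
  have hW3 : Module.finrank ℂ ↥W = 3 := by rw [hsum, h3]
  have hdisj : Disjoint (W ⊓ H.piece 1 0) (W ⊓ H.piece 0 1) := by
    rw [disjoint_iff, Submodule.eq_bot_iff]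
    rintro x ⟨⟨-, hx1⟩, ⟨-, hx0⟩⟩
    have h1 : Θ x = x := hΘ10 x hx1
    have h0 : Θ x = -x := hΘ01 x hx0
    have h2 : (2 : ℂ) • x = 0 := by
      rw [two_smul]
      nth_rw 2 [← h1]
      rw [h0, add_neg_cancel]
    exact (smul_eq_zero.1 h2).resolve_left two_ne_zero
  have hP1 : ∀ x ∈ W ⊓ H.piece 1 0, Θ x = (1 : ℂ) • x := fun x hx => by rw [one_smul]; exact hΘ10 x hx.2
  have hQ1 : ∀ x ∈ W ⊓ H.piece 0 1, Θ x = (-1 : ℂ) • x := fun x hx => by rw [neg_one_smul]; exact hΘ01 x hx.2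
  -- the two cases `(2,1)` and `(1,2)`
  rcases Nat.lt_or_ge (Module.finrank ℂ ↥(W ⊓ H.piece 0 1)) 2 with hlt | hge
  · have hQ : Module.finrank ℂ ↥(W ⊓ H.piece 0 1) = 1 := by omega
    have hP : Module.finrank ℂ ↥(W ⊓ H.piece 1 0) = 2 := by omega
    obtain ⟨bW, h0, h1, h2⟩ := CMNoTwist3.exists_basis_theta W (W ⊓ H.piece 1 0) (W ⊓ H.piece 0 1) inf_le_left
      inf_le_left hdisj hW3 hP hQ Θ 1 (-1) hP1 hQ1
    exact ⟨bW, 1, -1, by norm_num, h0, h1, h2⟩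
  · have hQ : Module.finrank ℂ ↥(W ⊓ H.piece 0 1) = 2 := by omega
    have hP : Module.finrank ℂ ↥(W ⊓ H.piece 1 0) = 1 := by omega
    obtain ⟨bW, h0, h1, h2⟩ := CMNoTwist3.exists_basis_theta W (W ⊓ H.piece 0 1) (W ⊓ H.piece 1 0) inf_le_left
      inf_le_left hdisj.symm hW3 hQ hP Θ (-1) 1 hQ1 hP1
    exact ⟨bW, -1, 1, by norm_num, h0, h1, h2⟩

/-! ### §2 Projection onto `𝔰𝔩₃` at a mixed block, hence at every block -/

/-- **At a MIXED `3`-block the complex derived span induces every traceless endomorphism** (the relative `𝔰𝔩₃` theorem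
`CMDerived.exists_mem_spanC_derived_forall_eq_three` run on a `Θ`-adapted basis).
[cite: MoonenZarhin1999LowDim, §2 (2.3)] [cite: Ribet1983, §3] [cite: Deligne1982HodgeCycles, I §3 (proof of Prop. 3.4)] -/
theorem CMNoTwist3.proj_of_mixed (H : HodgeStructure V n) (hn : n = 1) (heff : H.IsEffective)
    {φ : Module.End ℚ V} (hφE : φ ∈ H.endAlg)
    (𝔤 : Submodule ℚ (Module.End ℚ V)) (hbr : ∀ X ∈ 𝔤, ∀ X' ∈ 𝔤, X * X' - X' * X ∈ 𝔤)
    (hcomm : ∀ X ∈ 𝔤, ∀ a : H.endAlg, X * (a : Module.End ℚ V) = (a : Module.End ℚ V) * X)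
    {Θ : Module.End ℂ (ℂ ⊗[ℚ] V)} (hΘ : ∀ p, ∀ x ∈ H.piece p (n - p), Θ x = ((2 * p - n : ℤ) : ℂ) • x)
    (hΘ𝔤 : Θ ∈ spanC 𝔤) {c : ℂ}
    (hirr : ∀ U ≤ Module.End.eigenspace (φ.baseChange ℂ) c,
      (∀ X ∈ 𝔤, ∀ u ∈ U, X.baseChange ℂ u ∈ U) → U = ⊥ ∨ U = Module.End.eigenspace (φ.baseChange ℂ) c)
    (h3 : Module.finrank ℂ ↥(Module.End.eigenspace (φ.baseChange ℂ) c ⊓ H.piece 1 0) +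
      Module.finrank ℂ ↥(Module.End.eigenspace (φ.baseChange ℂ) c ⊓ H.piece 0 1) = 3)
    (h10 : Module.finrank ℂ ↥(Module.End.eigenspace (φ.baseChange ℂ) c ⊓ H.piece 1 0) ≠ 0)
    (h01 : Module.finrank ℂ ↥(Module.End.eigenspace (φ.baseChange ℂ) c ⊓ H.piece 0 1) ≠ 0)
    (Z : Module.End ℂ ↥(Module.End.eigenspace (φ.baseChange ℂ) c)) (hZ : LinearMap.trace ℂ _ Z = 0) :
    ∃ X ∈ spanC (Submodule.span ℚ {B | ∃ X ∈ 𝔤, ∃ X' ∈ 𝔤, X * X' - X' * X = B}),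
      ∀ w : ↥(Module.End.eigenspace (φ.baseChange ℂ) c), X w = Z w := by
  obtain ⟨bW, α, β, hαβ, h0, h1, h2⟩ := CMNoTwist3.exists_basis_of_mixed H hn heff hφE hΘ h3 h10 h01
  have hXW : ∀ X ∈ 𝔤, ∀ w ∈ Module.End.eigenspace (φ.baseChange ℂ) c,
      X.baseChange ℂ w ∈ Module.End.eigenspace (φ.baseChange ℂ) c := fun X hX w hw =>
    UnitaryTheta.apply_mem_eigenspace_of_commute (UnitaryTheta.baseChange_commute H hφE hcomm hX) hw
  exact CMDerived.exists_mem_spanC_derived_forall_eq_three 𝔤 hbr _ bW hXW hirr hΘ𝔤 hαβ h0 h1 h2 Z hZ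

/-- **PROJECTION ONTO `𝔰𝔩(W_{μ k})` AT EVERY BLOCK, GIVEN ONE MIXED `3`-BLOCK** (equidimensionality
`CMPlaces.forall_proj_of_proj` + `proj_of_mixed`): for `n₀ = 3` and a mixed place `k₁`, every traceless endomorphism
of every `W_{μ k}` — including the `Θ`-scalar `(3,0)`-blocks — is induced by an element of `(𝔡)_ℂ`.
[cite: MoonenZarhin1999LowDim, §2 (2.3)] [cite: Ribet1983, §3] [cite: Deligne1982HodgeCycles, I §3 (proof of Prop. 3.4)] -/
theorem CMNoTwist3.proj_of_exists_mixed {ι : Type} [Fintype ι] [DecidableEq ι]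
    (H : HodgeStructure V n) (hn : n = 1) (heff : H.IsEffective) (ψ : H.Polarization)
    {φ : Module.End ℚ V} (hφE : φ ∈ H.endAlg) {m : ℕ} (hE : ∀ a ∈ H.endAlg, ∃ q : Fin m → ℚ, a = ∑ k, q k • φ ^ (k : ℕ))
    (hEdim : Module.finrank ℚ H.endAlg = 2 * Fintype.card ι)
    (hdiv : ∀ a ∈ H.endAlg, a ≠ 0 → ∃ b : Module.End ℚ V, b * a = 1)
    (μ : ι → ℂ) (hinj : Function.Injective μ) (hdist : ∀ k k', μ k' ≠ starRingEnd ℂ (μ k))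
    (hrank : ∀ k, Module.finrank ℂ ↥(Module.End.eigenspace (φ.baseChange ℂ) (μ k) ⊓ H.piece 1 0) +
      Module.finrank ℂ ↥(Module.End.eigenspace (φ.baseChange ℂ) (μ k) ⊓ H.piece 0 1) = 3)
    (htop : (⨆ kt : ι × Fin 2, Module.End.eigenspace (φ.baseChange ℂ)
      (if kt.2 = 0 then μ kt.1 else starRingEnd ℂ (μ kt.1))) = ⊤)
    (𝔤 : Submodule ℚ (Module.End ℚ V)) (hbr : ∀ X ∈ 𝔤, ∀ X' ∈ 𝔤, X * X' - X' * X ∈ 𝔤)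
    (hcomm : ∀ X ∈ 𝔤, ∀ a : H.endAlg, X * (a : Module.End ℚ V) = (a : Module.End ℚ V) * X)
    (hskew : ∀ X ∈ 𝔤, ∀ v w, ψ.form (X v) w + ψ.form v (X w) = 0)
    {Θ : Module.End ℂ (ℂ ⊗[ℚ] V)} (hΘ : ∀ p, ∀ x ∈ H.piece p (n - p), Θ x = ((2 * p - n : ℤ) : ℂ) • x)
    (hΘ𝔤 : Θ ∈ spanC 𝔤)
    (k₁ : ι) (hirr₁ : ∀ U ≤ Module.End.eigenspace (φ.baseChange ℂ) (μ k₁),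
      (∀ X ∈ 𝔤, ∀ u ∈ U, X.baseChange ℂ u ∈ U) → U = ⊥ ∨ U = Module.End.eigenspace (φ.baseChange ℂ) (μ k₁))
    (h10 : Module.finrank ℂ ↥(Module.End.eigenspace (φ.baseChange ℂ) (μ k₁) ⊓ H.piece 1 0) ≠ 0)
    (h01 : Module.finrank ℂ ↥(Module.End.eigenspace (φ.baseChange ℂ) (μ k₁) ⊓ H.piece 0 1) ≠ 0)
    (k : ι) (Z : Module.End ℂ ↥(Module.End.eigenspace (φ.baseChange ℂ) (μ k))) (hZ : LinearMap.trace ℂ _ Z = 0) :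
    ∃ X ∈ spanC (Submodule.span ℚ {B | ∃ X ∈ 𝔤, ∃ X' ∈ 𝔤, X * X' - X' * X = B}),
      ∀ w : ↥(Module.End.eigenspace (φ.baseChange ℂ) (μ k)), X w = Z w :=
  CMPlaces.forall_proj_of_proj H hn heff ψ hφE hE hEdim hdiv μ hinj hdist (by norm_num) hrank htop 𝔤 hbr hcomm hskew k₁
    (fun Z' hZ' => CMNoTwist3.proj_of_mixed H hn heff hφE 𝔤 hbr hcomm hΘ hΘ𝔤 hirr₁ (hrank k₁) h10 h01 Z' hZ') k Z hZ

/-! ### §3 The LIFT property: one `Θ`-scalar place, one mixed place -/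

/-- **THE LIFT PROPERTY FOR `n₀ = 3`, ONE `Θ`-SCALAR PLACE AND ONE MIXED PLACE** (see the module docstring; `|ι| ≤ 2`,
`k₀` the `Θ`-scalar place, `k₁ ≠ k₀` mixed, `𝔤` bracket-closed admissible with `Θ ∈ 𝔤_ℂ` and every `W_{μ k}`
`𝔤`-irreducible): for every `k` and every traceless `Z ∈ End(W_{μ k})` there is `X ∈ 𝔤_ℂ` inducing `Z` on `W_{μ k}` and
`0` on the other block. [cite: MoonenZarhin1999LowDim, §2 (2.3)] [cite: Ribet1983, §3 and Thm. 0]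
[cite: Deligne1982HodgeCycles, I §3 (proof of Prop. 3.4)] -/
theorem CMNoTwist3.lift_of_scalar_mixed {ι : Type} [Fintype ι] [DecidableEq ι] (hι : Fintype.card ι ≤ 2)
    (H : HodgeStructure V n) (hn : n = 1) (heff : H.IsEffective) (ψ : H.Polarization)
    {φ : Module.End ℚ V} (hφE : φ ∈ H.endAlg) {m : ℕ} (hE : ∀ a ∈ H.endAlg, ∃ q : Fin m → ℚ, a = ∑ k, q k • φ ^ (k : ℕ))
    (hEdim : Module.finrank ℚ H.endAlg = 2 * Fintype.card ι)
    (hdiv : ∀ a ∈ H.endAlg, a ≠ 0 → ∃ b : Module.End ℚ V, b * a = 1)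
    (μ : ι → ℂ) (hinj : Function.Injective μ) (hdist : ∀ k k', μ k' ≠ starRingEnd ℂ (μ k))
    (hrank : ∀ k, Module.finrank ℂ ↥(Module.End.eigenspace (φ.baseChange ℂ) (μ k) ⊓ H.piece 1 0) +
      Module.finrank ℂ ↥(Module.End.eigenspace (φ.baseChange ℂ) (μ k) ⊓ H.piece 0 1) = 3)
    (htop : (⨆ kt : ι × Fin 2, Module.End.eigenspace (φ.baseChange ℂ)
      (if kt.2 = 0 then μ kt.1 else starRingEnd ℂ (μ kt.1))) = ⊤)
    (𝔤 : Submodule ℚ (Module.End ℚ V)) (hbr : ∀ X ∈ 𝔤, ∀ X' ∈ 𝔤, X * X' - X' * X ∈ 𝔤)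
    (hcomm : ∀ X ∈ 𝔤, ∀ a : H.endAlg, X * (a : Module.End ℚ V) = (a : Module.End ℚ V) * X)
    (hskew : ∀ X ∈ 𝔤, ∀ v w, ψ.form (X v) w + ψ.form v (X w) = 0)
    {Θ : Module.End ℂ (ℂ ⊗[ℚ] V)} (hΘ : ∀ p, ∀ x ∈ H.piece p (n - p), Θ x = ((2 * p - n : ℤ) : ℂ) • x)
    (hΘ𝔤 : Θ ∈ spanC 𝔤)
    (hirr : ∀ k, ∀ U ≤ Module.End.eigenspace (φ.baseChange ℂ) (μ k),
      (∀ X ∈ 𝔤, ∀ u ∈ U, X.baseChange ℂ u ∈ U) → U = ⊥ ∨ U = Module.End.eigenspace (φ.baseChange ℂ) (μ k))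
    (k₀ : ι) (hk₀ : Module.finrank ℂ ↥(Module.End.eigenspace (φ.baseChange ℂ) (μ k₀) ⊓ H.piece 1 0) = 0 ∨
      Module.finrank ℂ ↥(Module.End.eigenspace (φ.baseChange ℂ) (μ k₀) ⊓ H.piece 0 1) = 0)
    (hmix : ∀ k, k ≠ k₀ → Module.finrank ℂ ↥(Module.End.eigenspace (φ.baseChange ℂ) (μ k) ⊓ H.piece 1 0) ≠ 0 ∧
      Module.finrank ℂ ↥(Module.End.eigenspace (φ.baseChange ℂ) (μ k) ⊓ H.piece 0 1) ≠ 0)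
    (k₁ : ι) (hk₁ : k₁ ≠ k₀)
    (k : ι) (Z : Module.End ℂ ↥(Module.End.eigenspace (φ.baseChange ℂ) (μ k))) (hZ : LinearMap.trace ℂ _ Z = 0) :
    ∃ X ∈ spanC 𝔤, (∀ w : ↥(Module.End.eigenspace (φ.baseChange ℂ) (μ k)), X w = Z w) ∧
      ∀ j, j ≠ k → ∀ w ∈ Module.End.eigenspace (φ.baseChange ℂ) (μ j), X w = 0 := by
  classical
  -- notation and basic facts
  let W : ι → Submodule ℂ (ℂ ⊗[ℚ] V) := fun i => Module.End.eigenspace (φ.baseChange ℂ) (μ i)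
  have hWdef : ∀ i, W i = Module.End.eigenspace (φ.baseChange ℂ) (μ i) := fun i => rfl
  let 𝔡 : Submodule ℚ (Module.End ℚ V) := Submodule.span ℚ {B | ∃ X ∈ 𝔤, ∃ X' ∈ 𝔤, X * X' - X' * X = B}
  have h𝔡𝔤 : 𝔡 ≤ 𝔤 := CMDerived.derived_le hbr
  have h𝔇𝔊 : spanC 𝔡 ≤ spanC 𝔤 := spanC_mono h𝔡𝔤
  have hSφ : ∀ Y ∈ spanC 𝔤, Y * φ.baseChange ℂ = φ.baseChange ℂ * Y := fun Y hY =>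
    UnitaryTheta.commute_of_mem_spanC H hφE hcomm hY
  have hSW : ∀ Y ∈ spanC 𝔤, ∀ i, ∀ w ∈ W i, Y w ∈ W i := fun Y hY i w hw =>
    UnitaryTheta.apply_mem_eigenspace_of_commute (hSφ Y hY) hw
  have hXφ : ∀ X ∈ 𝔤, X.baseChange ℂ * φ.baseChange ℂ = φ.baseChange ℂ * X.baseChange ℂ := fun X hX =>
    UnitaryTheta.baseChange_commute H hφE hcomm hX
  have hXW : ∀ X ∈ 𝔤, ∀ i, ∀ w ∈ W i, X.baseChange ℂ w ∈ W i := fun X hX i w hw =>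
    UnitaryTheta.apply_mem_eigenspace_of_commute (hXφ X hX) hw
  have hΘφ : Θ * φ.baseChange ℂ = φ.baseChange ℂ * Θ := hSφ Θ hΘ𝔤
  have hfin : ∀ i, Module.finrank ℂ ↥(W i) = 3 := fun i => by
    rw [hWdef, CMTheta.finrank_eigenspace_eq_add H hn heff hφE, hrank i]
  haveI : ∀ i, Module.Finite ℂ ↥(W i) := fun i => Module.finite_of_finrank_eq_succ (hfin i)
  let bW : ∀ i, Module.Basis (Fin 3) ℂ ↥(W i) := fun i => Module.finBasisOfFinrankEq ℂ _ (hfin i)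
  -- the complex derived span `𝔇` and the inputs of Ribet's lemma
  have hbr𝔇 : ∀ X ∈ spanC 𝔡, ∀ Y ∈ spanC 𝔡, X * Y - Y * X ∈ spanC 𝔡 := fun X hX Y hY =>
    commutator_mem_spanC_derived (h𝔇𝔊 hX) (h𝔇𝔊 hY)
  have hW𝔇 : ∀ X ∈ spanC 𝔡, ∀ i, ∀ w ∈ W i, X w ∈ W i := fun X hX i => hSW X (h𝔇𝔊 hX) i
  have htr𝔇 : ∀ X (hX : X ∈ spanC 𝔡) i, LinearMap.trace ℂ _ (X.restrict (hW𝔇 X hX i)) = 0 := fun X hX i =>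
    CMDerived.trace_restrict_eq_zero (fun Y hY => hXW Y hY i) hX _
  have hproj : ∀ i, ∀ Z : Module.End ℂ ↥(W i), LinearMap.trace ℂ _ Z = 0 → ∃ X ∈ spanC 𝔡, ∀ w : ↥(W i), X w = Z w :=
    fun i Z hZ => CMNoTwist3.proj_of_exists_mixed H hn heff ψ hφE hE hEdim hdiv μ hinj hdist hrank htop 𝔤 hbr hcomm
      hskew hΘ hΘ𝔤 k₁ (hirr k₁) (hmix k₁ hk₁).1 (hmix k₁ hk₁).2 i Z hZ
  have P := fun i₀ => Literature.Algebra.Lie.LieGoursatTwist.lift_or_twist_of_submodules (k := ℂ) W (d := 3)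
    (by norm_num) bW (spanC 𝔡) hbr𝔇 hW𝔇 htr𝔇 hproj i₀
  -- the matrices `M i X = [X|_{W i}]`; zero matrix ⟺ zero restriction
  have hM0 : ∀ i X (hX : X ∈ spanC 𝔡), LinearMap.toMatrix (bW i) (bW i) (X.restrict (hW𝔇 X hX i)) = 0 ↔
      ∀ w ∈ W i, X w = 0 := by
    intro i X hX
    rw [LinearEquiv.map_eq_zero_iff]
    constructor
    · intro h w hw
      have h' := LinearMap.congr_fun h ⟨w, hw⟩
      rw [LinearMap.zero_apply] at h'
      have h'' := congrArg Subtype.val h'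
      rwa [LinearMap.coe_restrict_apply] at h''
    · intro h
      exact LinearMap.ext fun w => Subtype.ext (by rw [LinearMap.coe_restrict_apply, h w w.2]; rfl)
  -- a twist `(i₀, j)` of either type transports vanishing of restrictions in both directions
  have htrans : ∀ i₀ j (e : Fin 3 ≃ Fin 3) (A : Matrix (Fin 3) (Fin 3) ℂ), IsUnit A →
      ((∀ X (hX : X ∈ spanC 𝔡), LinearMap.toMatrix (bW i₀) (bW i₀) (X.restrict (hW𝔇 X hX i₀)) =
          A⁻¹ * (LinearMap.toMatrix (bW j) (bW j) (X.restrict (hW𝔇 X hX j))).submatrix e.symm e.symm * A) ∨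
        (2 < 3 ∧ ∀ X (hX : X ∈ spanC 𝔡), LinearMap.toMatrix (bW i₀) (bW i₀) (X.restrict (hW𝔇 X hX i₀)) =
          -(A⁻¹ * ((LinearMap.toMatrix (bW j) (bW j) (X.restrict (hW𝔇 X hX j))).submatrix e.symm e.symm)ᵀ * A))) →
      ∀ X (hX : X ∈ spanC 𝔡), ((∀ w ∈ W j, X w = 0) → ∀ w ∈ W i₀, X w = 0) ∧
        ((∀ w ∈ W i₀, X w = 0) → ∀ w ∈ W j, X w = 0) := by
    intro i₀ j e A hA htw X hX
    rcases htw with htw | ⟨-, htw⟩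
    · constructor
      · intro h
        rw [← hM0 i₀ X hX, htw X hX, (hM0 j X hX).2 h, Matrix.submatrix_zero, Pi.zero_def, Pi.zero_def,
          Matrix.mul_zero, Matrix.zero_mul]
      · intro h
        have h1 := htw X hX
        rw [(hM0 i₀ X hX).2 h] at h1
        exact (hM0 j X hX).1 (CMNoTwist.eq_zero_of_conj_submatrix_eq_zero e hA h1.symm)
    · constructor
      · intro h
        rw [← hM0 i₀ X hX, htw X hX, (hM0 j X hX).2 h, Matrix.submatrix_zero, Pi.zero_def, Pi.zero_def,
          Matrix.transpose_zero, Matrix.mul_zero, Matrix.zero_mul, neg_zero]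
      · intro h
        have h1 := htw X hX
        rw [(hM0 i₀ X hX).2 h] at h1
        exact (hM0 j X hX).1 (CMNoTwist3.eq_zero_of_conj_transpose_submatrix_eq_zero e hA h1.symm)
  -- a MIXED twist (between the `Θ`-scalar `k₀` and a mixed `b'`) is impossible
  have hmixed : ∀ b', (Module.finrank ℂ ↥(W b' ⊓ H.piece 1 0) ≠ 0 ∧ Module.finrank ℂ ↥(W b' ⊓ H.piece 0 1) ≠ 0) →
      (∀ X (hX : X ∈ spanC 𝔡), (∀ w ∈ W k₀, X w = 0) → ∀ w ∈ W b', X w = 0) → False := by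
    intro b' hb' himp
    obtain ⟨ε, hε⟩ := CMNoTwist.theta_eq_smul_of_unbalanced H hn heff hφE hΘ hk₀
    refine CMNoTwist.false_of_theta_commute_of_balanced H hn heff hΘ hΘφ 𝔤 hXφ (hirr b') hb'.1 hb'.2 fun X hX w hw => ?_
    have hC : Θ * X.baseChange ℂ - X.baseChange ℂ * Θ ∈ spanC 𝔡 :=
      commutator_mem_spanC_derived hΘ𝔤 (baseChange_mem_spanC hX)
    have hu0 : ∀ w ∈ W k₀, (Θ * X.baseChange ℂ - X.baseChange ℂ * Θ) w = 0 := fun w hw => by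
      rw [LinearMap.sub_apply, Module.End.mul_apply, Module.End.mul_apply, hε _ (hXW X hX k₀ w hw), hε w hw, map_smul,
        sub_self]
    have h := himp _ hC hu0 w hw
    rw [LinearMap.sub_apply, Module.End.mul_apply, Module.End.mul_apply, sub_eq_zero] at h
    exact h
  -- every place other than `k` and `k₀` … there is none
  have hthird : ∀ i j, i ≠ k₀ → j ≠ i → j = k₀ := by
    intro i j hi hj
    by_contra hj₀
    have h3 : ({i, j, k₀} : Finset ι).card = 3 := by
      rw [Finset.card_insert_of_notMem (by simp [hj.symm, hi]), Finset.card_insert_of_notMem (by simp [hj₀]),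
        Finset.card_singleton]
    have hle : ({i, j, k₀} : Finset ι).card ≤ Fintype.card ι := Finset.card_le_univ _
    omega
  -- the dichotomy at `k`
  rcases P k with h | ⟨j, hj, e, A, hA, htw⟩
  · obtain ⟨X, hX, h1, h2⟩ := h Z hZ
    exact ⟨X, h𝔇𝔊 hX, h1, h2⟩
  exfalso
  by_cases hkk₀ : k = k₀
  · subst hkk₀
    exact hmixed j (hmix j hj) fun X hX => (htrans k j e A hA htw X hX).2
  · have hjk₀ : j = k₀ := hthird k j hkk₀ hj
    subst hjk₀
    exact hmixed k (hmix k hkk₀) fun X hX => (htrans k j e A hA htw X hX).1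

end Hodge

end HodgeStructure

end Literature.AlgebraicGeometry.Motives
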